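import Mathlib.MeasureTheory.Integral.CurveIntegral.Poincare
import Literature.Analysis.Calculus.CommutativeLocalGroupLaw
import Literature.Analysis.Complex.OsgoodProofs
import HarnessLib

/-!
# The local logarithm of a commutative holomorphic local group law

Topic `Analysis/Calculus`; namespace `Literature.Analysis.Calculus`. Theorems only.

For a commutative holomorphic local group law `m` at `c` on a finite-dimensional complex normed
space (`IsCommHolomorphicLocalGroupLaw`, file `CommutativeLocalGroupLaw.lean`, where its
Maurer–Cartan form `ω y = (fderiv ℂ (m y) c)⁻¹` is shown to be analytic, translation invariant and
CLOSED near `c`), we construct **canonical coordinates**: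

* `IsCommHolomorphicLocalGroupLaw.exists_localLog` — there is `L : E → E`, analytic at `c`, with
  `L c = 0`, `HasFDerivAt L id c` (so `L` is a local biholomorphism by the inverse function
  theorem), `HasFDerivAt L (ω y) y` near `c`, and the **local homomorphism property**
  `L (m x y) = L x + L y` for `(x, y)` near `(c, c)`.

Proof: `ω` is exact on a ball about `c` by the Poincaré lemma for closed `1`-forms on convex sets
(Mathlib's `Convex.exists_forall_hasFDerivAt_of_fderiv_symmetric`, applied to the
`(E →L[ℂ] E)`-valued form, so the primitive is complex differentiable, and analytic by Osgood's
lemma `Literature.Analysis.Complex.SCV.analyticAt_of_differentiableOn`); for a primitive `L` and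
fixed `x`, `y ↦ L (m x y) - L y` has derivative `ω (m x y) ∘ fderiv (m x) y - ω y = 0` by
translation invariance, so it is constant on a ball, equal to its value `L (m x c) - L c = L x` at
`y = c`. This is the logarithm of the local group (for the group law of a commutative complex Lie
group in a chart at the identity: the local inverse of the exponential map; Mumford, *Abelian
Varieties*, §1; Lange, *Abelian Varieties over the Complex Numbers*, proof of Lemma 1.1.2, where it
enters through Hochschild's structure theorem for simply connected abelian Lie groups), obtained
without Lie algebras or one-parameter subgroups. Consumer:
`Literature/Geometry/Kaehler/CompactComplexLieGroupExp.lean` (the exponential map of a compact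
commutative complex Lie group and "compact connected complex Lie groups are complex tori").

## References

* C. Chevalley, *Theory of Lie Groups* (1946), Ch. IV §VIII (canonical coordinates), Ch. V §IV
  (forms of Maurer–Cartan: left invariance eq. (4), structure equations (2)–(3)). [Chevalley1946]
* N. Bourbaki, *Groupes et algèbres de Lie*, Ch. III §1 no. 10 (Lie group germs).
  [Bourbaki2006LieGroups23]
* D. Mumford, *Abelian Varieties* (1970), §1. [MumfordAV1970]
* H. Lange, *Abelian Varieties over the Complex Numbers* (2023), Lemma 1.1.2.
  [Lange2023AbelianVarietiesComplex]
-/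

noncomputable section

open Set Filter Function ContinuousLinearMap Metric
open scoped Topology ContDiff

namespace Literature.Analysis.Calculus

variable {E : Type*} [NormedAddCommGroup E] [NormedSpace ℂ E]

namespace IsCommHolomorphicLocalGroupLaw

variable {m : E → E → E} {c : E}

variable [CompleteSpace E] in
/-- **Additivity data near `(c, c)`** used to prove that a primitive of the Maurer–Cartan form is a
local homomorphism: for `(x, y)` near `(c, c)`, `m x y` is near `c`, the invariance relation holds
at `(x, y)`, and `b ↦ m x b` is differentiable at `y`. [folklore] -/
private theorem eventually_additivity_data (h : IsCommHolomorphicLocalGroupLaw m c) {s : Set E}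
    (hs : s ∈ 𝓝 c) :
    ∀ᶠ p : E × E in 𝓝 (c, c), m p.1 p.2 ∈ s ∧
      (fderiv ℂ (m (m p.1 p.2)) c).inverse.comp (fderiv ℂ (m p.1) p.2) =
        (fderiv ℂ (m p.2) c).inverse ∧
      HasFDerivAt (m p.1) (fderiv ℂ (m p.1) p.2) p.2 := by
  filter_upwards [h.tendsto_nhds.eventually (show ∀ᶠ y in 𝓝 c, y ∈ s from hs),
    h.eventually_mc_comp_fderiv, h.eventually_hasFDerivAt_snd] with p h1 h2 h3
  exact ⟨h1, h2, h3⟩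

/-- **The local logarithm of a commutative holomorphic local group law** (canonical coordinates of
the first kind, without Lie theory): there is a map `L`, analytic near `c`, with `L c = 0`,
derivative the identity at `c` (so `L` is a local biholomorphism, inverse function theorem) and,
near `c`, derivative the Maurer–Cartan form `y ↦ (fderiv (m y) c)⁻¹`, which is a LOCAL
HOMOMORPHISM to the additive group: `L (m x y) = L x + L y` for `(x, y)` near `(c, c)`.
Construction: the Maurer–Cartan form is closed (`eventually_fderiv_mc_symm`), hence exact on a
ball (Poincaré lemma, Mathlib's `Convex.exists_forall_hasFDerivAt_of_fderiv_symmetric`); a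
primitive `L` satisfies `d/dy (L (m x y) - L y) = 0` by invariance of the form, so
`L (m x y) - L y = L (m x c) - L c = L x`. For the group law of a commutative complex Lie group in
a chart at the identity this is the logarithm, the local inverse of the exponential map
(Mumford, *Abelian Varieties*, §1; Lange, *Abelian Varieties over the Complex Numbers*, proof of
Lemma 1.1.2); canonical coordinates of a Lie group germ: Chevalley, *Theory of Lie Groups*,
Ch. IV §VIII and Ch. V §§IV–V. [cite: Chevalley1946, Ch. IV §VIII] -/
theorem exists_localLog [FiniteDimensional ℂ E] (h : IsCommHolomorphicLocalGroupLaw m c) :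
    ∃ L : E → E, L c = 0 ∧ ContDiffAt ℂ ω L c ∧
      HasFDerivAt L (ContinuousLinearMap.id ℂ E) c ∧
      (∀ᶠ y in 𝓝 c, HasFDerivAt L (fderiv ℂ (m y) c).inverse y) ∧
      ∀ᶠ p : E × E in 𝓝 (c, c), L (m p.1 p.2) = L p.1 + L p.2 := by
  haveI : CompleteSpace E := FiniteDimensional.complete ℂ E
  set Ω : E → E →L[ℂ] E := fun y ↦ (fderiv ℂ (m y) c).inverse with hΩ
  -- a ball on which the Maurer–Cartan form is analytic and closed
  obtain ⟨ε, hε, hball⟩ : ∃ ε > 0, ∀ y ∈ ball c ε, ContDiffAt ℂ ω Ω y ∧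
      ∀ v w : E, fderiv ℂ Ω y v w = fderiv ℂ Ω y w v :=
    Metric.eventually_nhds_iff_ball.1 (h.eventually_contDiffAt_mc.and h.eventually_fderiv_mc_symm)
  have hdiffC : ∀ y ∈ ball c ε, DifferentiableAt ℂ Ω y :=
    fun y hy ↦ (hball y hy).1.differentiableAt (by simp)
  have hdiff : DifferentiableOn ℝ Ω (ball c ε) :=
    fun y hy ↦ ((hdiffC y hy).restrictScalars ℝ).differentiableWithinAt
  have hsymm : ∀ a ∈ ball c ε, ∀ v w : E, fderiv ℝ Ω a v w = fderiv ℝ Ω a w v := by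
    intro a ha v w
    rw [(hdiffC a ha).fderiv_restrictScalars ℝ]
    exact (hball a ha).2 v w
  -- Poincaré lemma
  obtain ⟨f, hf⟩ := (convex_ball c ε).exists_forall_hasFDerivAt_of_fderiv_symmetric isOpen_ball
    hdiff hsymm
  refine ⟨fun y ↦ f y - f c, sub_self _, ?_, ?_, ?_, ?_⟩
  · -- analytic at `c`: differentiable on the open ball (Osgood)
    have hd : DifferentiableOn ℂ (fun y ↦ f y - f c) (ball c ε) :=
      fun y hy ↦ ((hf y hy).differentiableAt.sub_const _).differentiableWithinAt
    exact (Literature.Analysis.Complex.SCV.analyticAt_of_differentiableOn hd isOpen_ball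
      (mem_ball_self hε)).contDiffAt
  · have := (hf c (mem_ball_self hε)).sub_const (f c)
    rwa [show Ω c = ContinuousLinearMap.id ℂ E from h.mc_self] at this
  · filter_upwards [ball_mem_nhds c hε] with y hy
    exact (hf y hy).sub_const (f c)
  · -- additivity on a smaller ball
    obtain ⟨δ, hδ, hδball⟩ : ∃ δ > 0, ∀ p ∈ ball (c, c) δ, m p.1 p.2 ∈ ball c ε ∧
        (fderiv ℂ (m (m p.1 p.2)) c).inverse.comp (fderiv ℂ (m p.1) p.2) =
          (fderiv ℂ (m p.2) c).inverse ∧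
        HasFDerivAt (m p.1) (fderiv ℂ (m p.1) p.2) p.2 ∧ m p.1 c = p.1 :=
      Metric.eventually_nhds_iff_ball.1 (((h.eventually_additivity_data (ball_mem_nhds c hε)).and
        ((continuous_fst.continuousAt (x := (c, c))).eventually h.right_id)).mono
          fun p hp ↦ ⟨hp.1.1, hp.1.2.1, hp.1.2.2, hp.2⟩)
    set δ' := min δ ε with hδ'
    have hδ'pos : 0 < δ' := lt_min hδ hε
    have hsub : ∀ {x y : E}, x ∈ ball c δ' → y ∈ ball c δ' → (x, y) ∈ ball (c, c) δ := by
      intro x y hx hy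
      rw [← ball_prod_same]
      exact ⟨ball_subset_ball (min_le_left _ _) hx, ball_subset_ball (min_le_left _ _) hy⟩
    have hsubε : ball c δ' ⊆ ball c ε := ball_subset_ball (min_le_right _ _)
    -- for fixed `x`, `y ↦ L (m x y) - L y` has zero derivative on the ball, hence is constant
    have hconst : ∀ x ∈ ball c δ', ∀ y ∈ ball c δ',
        (f (m x y) - f c) - (f y - f c) = (f (m x c) - f c) - (f c - f c) := by
      intro x hx y hy
      have hderiv : ∀ z ∈ ball c δ',
          HasFDerivAt (fun z ↦ (f (m x z) - f c) - (f z - f c)) (0 : E →L[ℂ] E) z := by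
        intro z hz
        obtain ⟨h1, h2, h3, -⟩ := hδball (x, z) (hsub hx hz)
        have hL1 : HasFDerivAt (fun z ↦ f (m x z) - f c)
            ((fderiv ℂ (m (m x z)) c).inverse.comp (fderiv ℂ (m x) z)) z :=
          ((hf _ h1).comp z h3).sub_const (f c)
        have hL2 : HasFDerivAt (fun z ↦ f z - f c) (fderiv ℂ (m z) c).inverse z :=
          (hf z (hsubε hz)).sub_const (f c)
        have := hL1.sub hL2
        rwa [h2, sub_self] at this
      refine isOpen_ball.is_const_of_fderiv_eq_zero (convex_ball c δ').isPreconnected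
        (fun z hz ↦ (hderiv z hz).differentiableAt.differentiableWithinAt)
        (fun z hz ↦ (hderiv z hz).fderiv) hy (mem_ball_self hδ'pos)
    refine Metric.eventually_nhds_iff_ball.2 ⟨δ', hδ'pos, fun p hp ↦ ?_⟩
    have hp' : p.1 ∈ ball c δ' ∧ p.2 ∈ ball c δ' := by
      rw [← ball_prod_same] at hp
      exact hp
    have hxc : m p.1 c = p.1 := (hδball (p.1, c) (hsub hp'.1 (mem_ball_self hδ'pos))).2.2.2
    have := hconst p.1 hp'.1 p.2 hp'.2
    rw [hxc, sub_self, sub_zero] at this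
    show f (m p.1 p.2) - f c = (f p.1 - f c) + (f p.2 - f c)
    rw [← this]
    abel

end IsCommHolomorphicLocalGroupLaw

end Literature.Analysis.Calculus
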